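import Literature.Computability.Cryptography.LiuPassRegular
import HarnessLib

/-!
# Liu–Pass, Lemma 5.4 (step 2): every one-way function is a regular `S`-one-way function on a dense `S`

Second piece of the decomposition of `condEPPRG_of_OWFExist` (Liu–Pass, FOCS 2020, Thm 5.5),
continuing `LiuPassRegular.lean` (Claim 3: the dense regular domains `S_n = lpRegSet f n`). Here:
the notion of a **one-way function over `S`** (`𝒮`-OWF, Liu–Pass §5.3 Def.: negligible inversion
probability when the input is drawn uniformly from `S_n` instead of `{0,1}ⁿ`) and the remaining
half of Lemma 5.4 — *one-wayness survives the restriction to a dense domain*: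

* `sInvertProb f 𝒜 S n = Pr_{x ← S_n, r}[𝒜(1ⁿ, f x; r) ∈ f⁻¹(f x)]` and `IsSOWF f S`;
* `sInvertProb_le_mul_invertProb` — for `2ⁿ ≤ n·|S_n|`, `sInvertProb ≤ n · invertProb`
  (the sum over `S_n` is part of the sum over `{0,1}ⁿ`);
* `isSOWF_of_isOneWay` — hence a one-way `f` is an `𝒮`-OWF for every `S` of density `≥ 1/n`
  (`n · negligible` is negligible, `SuperpolynomialDecay.param_mul`);
* `isSOWF_lpRegSet` (**Lemma 5.4**) — in particular on Liu–Pass's dense regular domains, on which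
  `f` is regular with regularity `lpRegIdx f` (`preimCard_of_mem_lpRegSet`).

What remains of Thm 5.5 for the sequel: Lemma 5.3 (a cond EP-PRG from a regular `𝒮`-OWF via
hashing and Goldreich–Levin, to be vendored as a named fact in these terms) and the assembly.

## References

* Y. Liu, R. Pass, *On one-way functions and Kolmogorov complexity*, FOCS 2020
  (arXiv:2009.11514), §5.3 (Def. of `𝒮`-OWF), Lemma 5.4 ("It only remains to show that `f` is a
  `𝒮`-OWF; this …").
* O. Goldreich, *Foundations of Cryptography I*, CUP 2001, Def. 2.2.1, §3.5.
-/

namespace Literature.Computability.Cryptography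

open Finset Filter Asymptotics _root_.Computability Complexity

/-- `sInvertProb f 𝒜 S n`: the probability that `𝒜`, given `(1ⁿ, f x)`, outputs a preimage of
`f x`, averaged over `x` drawn **uniformly from `S_n`** and the coins of `𝒜` (`0` if `S_n = ∅`).
[Y. Liu, R. Pass, FOCS 2020, §5.3 (Def. `𝒮`-OWF)] [cite: LiuPassFOCS2020, Lemma 5.4] -/
noncomputable def sInvertProb (f : List Bool → List Bool) (A : RandAlg (List Bool) (List Bool))
    (S : ∀ n : ℕ, Finset (List.Vector Bool n)) (n : ℕ) : ℝ :=
  (∑ x ∈ S n, A.pr id (boolPair (unaryEncodeNat n) (f x.toList)) {z | f z = f x.toList}) / (S n).card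

/-- **`𝒮`-one-way function**: `f` is polynomial-time computable and every PPT inverter succeeds
with negligible probability on inputs drawn uniformly from `S_n`.
[Y. Liu, R. Pass, FOCS 2020, §5.3 (Def. "one-way function over `𝒮`")] [cite: LiuPassFOCS2020, Lemma 5.4] -/
def IsSOWF (f : List Bool → List Bool) (S : ∀ n : ℕ, Finset (List.Vector Bool n)) : Prop :=
  PolyTimeComputable id id f ∧
    ∀ A : RandAlg (List Bool) (List Bool), IsPPT A id →
      SuperpolynomialDecay atTop (fun n : ℕ => (n : ℝ)) (sInvertProb f A S)

/-- `sInvertProb` is nonnegative. [folklore] -/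
theorem sInvertProb_nonneg (f : List Bool → List Bool) (A : RandAlg (List Bool) (List Bool))
    (S : ∀ n : ℕ, Finset (List.Vector Bool n)) (n : ℕ) : 0 ≤ sInvertProb f A S n :=
  div_nonneg (sum_nonneg fun _ _ => A.pr_nonneg _ _ _) (Nat.cast_nonneg _)

/-- **Restriction to a dense domain costs at most the density factor**: if `2ⁿ ≤ n · |S_n|` then
`Pr_{x ← S_n}[𝒜 inverts] ≤ n · Pr_{x ← U_n}[𝒜 inverts]` (the sum over `S_n` is part of the sum
over `{0,1}ⁿ`). [Y. Liu, R. Pass, FOCS 2020, proof of Lemma 5.4] [cite: LiuPassFOCS2020, Lemma 5.4] -/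
theorem sInvertProb_le_mul_invertProb (f : List Bool → List Bool) (A : RandAlg (List Bool) (List Bool))
    {S : ∀ n : ℕ, Finset (List.Vector Bool n)} {n : ℕ} (hS : 2 ^ n ≤ n * (S n).card) :
    sInvertProb f A S n ≤ n * invertProb f A n := by
  set g : List.Vector Bool n → ℝ := fun x => A.pr id (boolPair (unaryEncodeNat n) (f x.toList)) {z | f z = f x.toList}
    with hg
  have hg0 : ∀ x, 0 ≤ g x := fun x => A.pr_nonneg _ _ _
  have hcard : 0 < (S n).card := by
    have : 0 < 2 ^ n := Nat.two_pow_pos n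
    by_contra h
    push Not at h
    have h0 : (S n).card = 0 := by omega
    rw [h0, Nat.mul_zero] at hS
    omega
  have hsum : ∑ x ∈ S n, g x ≤ ∑ x : List.Vector Bool n, g x :=
    sum_le_sum_of_subset_of_nonneg (subset_univ _) fun x _ _ => hg0 x
  have hinv : invertProb f A n = (∑ x : List.Vector Bool n, g x) / 2 ^ n := rfl
  have hs : sInvertProb f A S n = (∑ x ∈ S n, g x) / (S n).card := rfl
  rw [hs, hinv, div_le_iff₀ (by exact_mod_cast hcard)]
  have h2 : (0 : ℝ) < 2 ^ n := by positivity
  have hS' : ((2 : ℝ) ^ n) ≤ n * (S n).card := by exact_mod_cast hS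
  have hsum0 : 0 ≤ ∑ x : List.Vector Bool n, g x := sum_nonneg fun x _ => hg0 x
  calc ∑ x ∈ S n, g x ≤ ∑ x : List.Vector Bool n, g x := hsum
    _ = ((∑ x : List.Vector Bool n, g x) / 2 ^ n) * 2 ^ n := by rw [div_mul_cancel₀ _ h2.ne']
    _ ≤ ((∑ x : List.Vector Bool n, g x) / 2 ^ n) * (n * (S n).card) :=
        mul_le_mul_of_nonneg_left hS' (div_nonneg hsum0 h2.le)
    _ = n * ((∑ x : List.Vector Bool n, g x) / 2 ^ n) * (S n).card := by ring

/-- **One-wayness survives restriction to a dense domain**: a one-way `f` is an `𝒮`-OWF for every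
`S` with `2ⁿ ≤ n · |S_n|` for all `n ≥ 1`. [Y. Liu, R. Pass, FOCS 2020, proof of Lemma 5.4]
[cite: LiuPassFOCS2020, Lemma 5.4] -/
theorem isSOWF_of_isOneWay {f : List Bool → List Bool} (hf : IsOneWay f) {S : ∀ n : ℕ, Finset (List.Vector Bool n)}
    (hS : ∀ n, 1 ≤ n → 2 ^ n ≤ n * (S n).card) : IsSOWF f S := by
  refine ⟨hf.1, fun A hA => ?_⟩
  have hdec : SuperpolynomialDecay atTop (fun n : ℕ => (n : ℝ)) fun n => (n : ℝ) * invertProb f A n :=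
    (hf.2 A hA).param_mul
  refine hdec.trans_eventually_abs_le ?_
  filter_upwards [eventually_ge_atTop 1] with n hn
  show |sInvertProb f A S n| ≤ |(n : ℝ) * invertProb f A n|
  rw [abs_of_nonneg (sInvertProb_nonneg f A S n),
    abs_of_nonneg (mul_nonneg (Nat.cast_nonneg n) (invertProb_nonneg f A n))]
  exact sInvertProb_le_mul_invertProb f A (hS n hn)

/-- **Liu–Pass, Lemma 5.4**: every one-way function `f` is an `𝒮`-OWF on its dense regular
domains `S_n = lpRegSet f n` (of density `≥ 1/n`, on which `f` is regular with regularity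
`lpRegIdx f`, `preimCard_of_mem_lpRegSet`). [Y. Liu, R. Pass, FOCS 2020, Lemma 5.4]
[cite: LiuPassFOCS2020, Lemma 5.4] -/
theorem isSOWF_lpRegSet {f : List Bool → List Bool} (hf : IsOneWay f) : IsSOWF f (lpRegSet f) :=
  isSOWF_of_isOneWay hf fun _ hn => card_lpRegSet f hn

end Literature.Computability.Cryptography
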